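import Mathlib.MeasureTheory.Measure.SeparableMeasure
import Mathlib.Analysis.Distribution.AEEqOfIntegralContDiff
import Literature.Analysis.FluidPDE.ClassicalSolutionCalculus
import Literature.Analysis.FunctionSpaces.TimeMollification
import Literature.Analysis.FunctionSpaces.DuBoisReymond
import HarnessLib

/-!
# From distributional (pressure-explicit) to weak (pressure-free) solutions with datum

Analysis/FluidPDE proofs file for the named fact
`Literature.Analysis.FluidPDE.IsDistributionalNSSolutionOn.isWeakNSSolutionOn_of` of
`Literature.Analysis.FluidPDE.WeakSolution` ("dropping the pressure": a distributional
solution of the forced Navier–Stokes system on the open slab `(0, T) × E` in the sense of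
Caffarelli–Kohn–Nirenberg 1982, (2.1)–(2.5), which is locally square integrable up to `t = 0`
and attains the datum `u₀` in `L²_loc` as `t → 0⁺`, is a weak solution on `[0, T)` with datum
`u₀` in Leray's pressure-free form (17), tested against divergence-free fields).

## The vendored statement is mis-stated; the corrected fact is proved

`isWeakNSSolutionOn_of` is **false as written** (in every dimension `≥ 2`): it quantifies over an
arbitrary datum `u₀ : E → E` which enters the hypotheses only through the lower Lebesgue
integrals `∫⁻ x in K, ‖u t x - u₀ x‖ₑ ^ 2` of `h₀`. These do not see non-measurable
perturbations: if `ũ₀` is the (measurable) `L²_loc`-limit of `u(t)` and `A ⊆ E` is a set all of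
whose measurable subsets are null but which is not null-measurable in any non-empty open set
(a Bernstein set), then `u₀ := ũ₀ + 𝟙_A w` still satisfies `h₀`, because
`‖u t - u₀‖ₑ² ≤ 2‖u t - ũ₀‖ₑ² + 2‖w‖² 𝟙_A` and Mathlib's `lintegral_add_left` (measurable first
summand, *arbitrary* second summand) together with `∫⁻ 𝟙_A = 0` (every simple function below
`𝟙_A` has null support). But `x ↦ ⟪u₀ x, ψ 0 x⟫` is then not a.e.-strongly measurable whenever
`⟪w, ψ(0, ·)⟫ ≢ 0`, so the Bochner integral `∫ ⟪u₀, ψ 0⟫` in the conclusion is `0` by convention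
(`integral_non_aestronglyMeasurable`), while the space–time part of the weak identity equals
`-∫ ⟪ũ₀, ψ 0⟫`, which is `≠ 0` e.g. for the stationary classical solution `u = ũ₀` (a non-zero
smooth compactly supported divergence-free field, `p = 0`, `f := (u·∇)u - νΔu`) tested with
`ψ = χ(t) ũ₀(x)`, `χ(0) = 1`. In the printed sources the datum is a distribution / an `L²_loc`
(in particular measurable) field (Lemarié-Rieusset 2016, Def. 6.2, PDF p. 126: `u` locally square
integrable on `(0,T) × ℝ³`, `u(t) → u₀` in `𝒟'`; Robinson–Rodrigo–Sadowski 2016, Def. 3.3,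
PDF p. 59: `u₀ ∈ H`; Caffarelli–Kohn–Nirenberg 1982, §2 — not held here, acquisition request
acq-00031), so the faithful repair is to add the hypothesis `AEStronglyMeasurable u₀ volume`;
nothing else is changed. This is the corrected fact
`IsDistributionalNSSolutionOn.isWeakNSSolutionOn_of_aestronglyMeasurable` (same citation), and it
is **proved** here (`…_of_aestronglyMeasurable_holds`, usable form
`IsDistributionalNSSolutionOn.isWeakNSSolutionOn_datum`). The measure-theoretic half of the
loophole is recorded formally at the end of the file
(`lintegral_indicator_const_eq_zero_of_forall_subset_null`,
`tendsto_lintegral_sub_add_of_lintegral_eq_zero`): the datum hypothesis `h₀` is preserved under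
`u₀ ↦ u₀ + 𝟙_A w` whenever all measurable subsets of `A` are null.

## Proof architecture

Write `Q = (0,T) × E`, `dμ = dt|_(0,T) ⊗ dx` (`volume_restrict_slab_eq`).

* Measurability on the slab is that of a locally integrable function; `u, ‖u‖² ∈ L¹((0,T) × K)`
  for compact `K` (`integrableOn_cylinder_of_lintegral_sq`), hence every pairing of `u` (or `f`)
  with a continuous field vanishing off `K`, and the quadratic pairing `⟪u, Dψ u⟫`, is
  `μ`-integrable (`integrable_slab_inner`, `integrable_slab_inner_clm_apply`); Tonelli gives
  that a.e. slice `u(t)` is measurable and in `L²_loc` (`ae_slice_aestronglyMeasurable_and_…`).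
* *A.e. weak divergence-freeness.* For a fixed test function `θ` on `E`, testing the
  distributional divergence condition with `η ⊗ θ`, `η ∈ C_c^∞((0,T))`, Fubini and the
  fundamental lemma of the calculus of variations in `t`
  (Mathlib's `IsOpen.ae_eq_zero_of_integral_contDiff_smul_eq_zero`) give `∫ ⟪u(t), ∇θ⟫ = 0` for
  a.e. `t` (`ae_integral_inner_gradient_eq_zero`). The null set is made independent of `θ` by a
  separability argument (`ae_isWeaklyDivFree_of_forall_test`): the gradients of the test
  functions supported in `B̄(0,n)` form a subset of the second-countable Hilbert space
  `L²(B̄(0,n); E)` (Mathlib's `Lp.SecondCountableTopology`), hence admit a countable dense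
  subfamily, and the annihilator of `u(t) ∈ L²(B̄(0,n))` is closed
  (Robinson–Rodrigo–Sadowski 2016, PDF p. 90: "for almost every `t`, `⟨u(t), ∇η⟩ = 0` for every
  `η`").
* *The weak identity with datum* (`weakIdentity_datum_of_distributional`): for a test field `ψ`
  on `(-∞,T) × E` with divergence-free slices and a smooth monotone cut-off `η_δ` (`0` on
  `(-∞, δ]`, `1` on `[3δ, ∞)`, `η_δ' = ρ_δ ≥ 0` a unit-mass bump supported in `(δ, 3δ)`;
  `exists_smooth_time_cutoff`, built on the accepted `Literature.Analysis.FunctionSpaces.contDiff_primitive_normed`), the field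
  `η_δ ψ` is a test field on `Q` (`IsSpaceTimeTestOn.cutoff`); in the distributional identity the
  pressure term is `∫∫ p η_δ div ψ = 0` and `∂ₜ(η_δ ψ) = ρ_δ ψ + η_δ ∂ₜψ`, so
  `∫∫ η_δ Φ dμ + ∫₀ᵀ ρ_δ(t) ⟨u(t), ψ(t)⟩ dt = 0` with `Φ` the weak integrand. As `δ → 0` the
  first term tends to `∫∫ Φ dμ = ∫₀ᵀ ∫ Φ` (dominated convergence, Fubini) and the second to
  `⟨u₀, ψ(0)⟩` (`tendsto_setIntegral_mul_of_ae_tendsto`), because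
  `⟨u(t), ψ(t)⟩ → ⟨u₀, ψ(0)⟩` along a.e. `t → 0⁺` (`exists_ae_abs_pairing_sub_datum_le`:
  Cauchy–Schwarz with `h₀`, uniform continuity of `ψ`, and `u₀ ∈ L²_loc`, which follows from
  `h₀`, the hypothesis on `u` and — essentially — the measurability of `u₀`,
  `lintegral_datum_sq_lt_top`). This is the time integration by parts of
  Robinson–Rodrigo–Sadowski 2016, §3.1 (PDF p. 58, derivation of (3.1)) performed on the weak
  level.

## Mathlib search

Mathlib (this pin) has no Navier–Stokes notions; used: `Lp.SecondCountableTopology`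
(`MeasureTheory/Measure/SeparableMeasure`), `IsOpen.ae_eq_zero_of_integral_contDiff_smul_eq_zero`
(`Analysis/Distribution/AEEqOfIntegralContDiff`), `tendsto_integral_of_dominated_convergence`,
`integral_prod`, `lintegral_prod`, `AEStronglyMeasurable.prodMk_left`, `ContDiffBump`. From the
tree: `ClassicalSolutionCalculus` (joint regularity of test fields), `TimeMollification`
(Cauchy–Schwarz for pairings), `DuBoisReymond` (primitives of bumps), `WholeSpaceIBP`.

## References

* L. Caffarelli, R. Kohn, L. Nirenberg, *Partial regularity of suitable weak solutions of the
  Navier–Stokes equations*, Comm. Pure Appl. Math. 35 (1982), §2, (2.1)–(2.5).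
  [CaffarelliKohnNirenberg1982] (not held: acq-00031)
* J. C. Robinson, J. L. Rodrigo, W. Sadowski, *The Three-Dimensional Navier–Stokes Equations*,
  CUP 2016, §3.1 (PDF p. 58, (3.1)), Def. 3.3, Ch. 5 (PDF p. 90). [RobinsonRodrigoSadowski2016]
* P. G. Lemarié-Rieusset, *The Navier–Stokes Problem in the 21st Century*, CRC 2016, Def. 6.2
  (PDF p. 126). [LemarieRieusset2016]
* J. Leray, *Sur le mouvement d'un liquide visqueux emplissant l'espace*, Acta Math. 63 (1934),
  (17). [Leray1934]
-/

noncomputable section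

open MeasureTheory TopologicalSpace Set Function Filter Topology InnerProductSpace Metric
open scoped RealInnerProductSpace ENNReal NNReal Laplacian

namespace Literature.Analysis.FluidPDE

/-! ### A.e. weak divergence-freeness from test-wise a.e. vanishing -/

section AEDivFree

variable {E : Type*} [NormedAddCommGroup E] [InnerProductSpace ℝ E] [FiniteDimensional ℝ E]
  [MeasurableSpace E] [BorelSpace E]

/-- The gradient of a test function is continuous with compact support, hence in `L²` of every
restriction of Lebesgue measure. [folklore] -/
theorem memLp_gradient_restrict_of_isTestFunctionOn {θ : E → ℝ}
    (hθ : FunctionSpaces.IsTestFunctionOn (⊤ : Opens E) θ) (s : Set E) :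
    MemLp (gradient θ) 2 ((volume : Measure E).restrict s) := by
  have hc : Continuous (gradient θ) :=
    continuous_gradient_of_contDiff (contDiff_infty.1 hθ.contDiff 1)
  have hs : HasCompactSupport (gradient θ) := by
    refine hθ.hasCompactSupport.mono' fun x hx => ?_
    by_contra h
    exact hx (gradient_eq_zero_of_notMem_tsupport h)
  exact (hc.memLp_of_hasCompactSupport hs).restrict s

/-- An a.e.-measurable slice with `∫⁻_K ‖v‖² < ∞` is in `L²(K)`. [folklore] -/
theorem memLp_two_restrict_of_lintegral_lt_top {v : E → E} {K : Set E}
    (hv : AEStronglyMeasurable v (volume : Measure E))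
    (hK : ∫⁻ x in K, ‖v x‖ₑ ^ 2 < ∞) :
    MemLp v 2 ((volume : Measure E).restrict K) := by
  refine ⟨hv.restrict, ?_⟩
  rw [eLpNorm_lt_top_iff_lintegral_rpow_enorm_lt_top two_ne_zero ENNReal.ofNat_ne_top]
  simpa [ENNReal.toReal_ofNat] using hK

/-- **A.e. weak divergence-freeness from test-wise a.e. vanishing** (separability argument).
Let `v : α → E → E` be a family of vector fields, a.e. of which are a.e.-strongly measurable and
locally square integrable, and suppose that for every single test function `θ` the pairing
`∫ ⟪v a, ∇θ⟫` vanishes for a.e. `a`. Then a.e. `v a` is weakly divergence free, i.e. the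
exceptional null set can be chosen independently of `θ`: for each `n` the gradients of the test
functions supported in the ball of radius `n` form a subset of the separable Hilbert space
`L²(B̄(0,n); E)`, hence have a countable dense subfamily; the pairing with `v a ∈ L²(B̄(0,n))`
is continuous on `L²`, so vanishing on the countable subfamily (a countable intersection of full
measure sets) gives vanishing on all test functions
(Robinson–Rodrigo–Sadowski 2016, proof of Prop. 5.3, PDF p. 90: "for almost every `t`,
`⟨u(t), ∇η⟩ = 0` for every `η`"). [folklore] -/
theorem ae_isWeaklyDivFree_of_forall_test {α : Type*} [MeasurableSpace α] {μ : Measure α}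
    {v : α → E → E}
    (hv : ∀ᵐ a ∂μ, AEStronglyMeasurable (v a) (volume : Measure E) ∧
      ∀ n : ℕ, ∫⁻ x in closedBall (0 : E) n, ‖v a x‖ₑ ^ 2 < ∞)
    (h : ∀ θ : E → ℝ, FunctionSpaces.IsTestFunctionOn (⊤ : Opens E) θ →
      ∀ᵐ a ∂μ, ∫ x, ⟪v a x, gradient θ x⟫ = 0) :
    ∀ᵐ a ∂μ, IsWeaklyDivFree (v a) := by
  haveI : Fact ((2 : ℝ≥0∞) ≠ ⊤) := ⟨ENNReal.ofNat_ne_top⟩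
  -- test functions supported in the closed ball of radius `n`, and the restricted measures
  set Tn : ℕ → Set (E → ℝ) := fun n =>
    {θ | FunctionSpaces.IsTestFunctionOn (⊤ : Opens E) θ ∧ tsupport θ ⊆ closedBall (0 : E) n} with hTn
  set μn : ℕ → Measure E := fun n => (volume : Measure E).restrict (closedBall (0 : E) n) with hμn
  have hmem : ∀ n (θ : Tn n), MemLp (gradient (θ : E → ℝ)) 2 (μn n) := fun n θ =>
    memLp_gradient_restrict_of_isTestFunctionOn θ.2.1 _
  -- `F n θ = [∇θ] ∈ L²(μn)`
  set F : ∀ n, Tn n → Lp E 2 (μn n) := fun n θ => (hmem n θ).toLp with hF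
  have hzero : ∀ n, (0 : E → ℝ) ∈ Tn n := fun n =>
    ⟨FunctionSpaces.isTestFunctionOn_zero _, by simp⟩
  haveI hne : ∀ n, Nonempty (range (F n)) := fun n => ⟨⟨F n ⟨0, hzero n⟩, mem_range_self _⟩⟩
  -- a dense sequence in the range of `F n` and test functions realising it
  set sq : ∀ n, ℕ → range (F n) := fun n => denseSeq (range (F n)) with hsq
  have hsq_dense : ∀ n, DenseRange (sq n) := fun n => denseRange_denseSeq _
  have hex : ∀ n k, ∃ θ : Tn n, F n θ = (sq n k : Lp E 2 (μn n)) := fun n k => (sq n k).2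
  choose θs hθs using hex
  -- the good parameters
  have hgood : ∀ᵐ a ∂μ, (AEStronglyMeasurable (v a) (volume : Measure E) ∧
      ∀ n : ℕ, ∫⁻ x in closedBall (0 : E) n, ‖v a x‖ₑ ^ 2 < ∞) ∧
      ∀ n k : ℕ, ∫ x, ⟪v a x, gradient (θs n k : E → ℝ) x⟫ = 0 := by
    refine hv.and ?_
    rw [ae_all_iff]
    intro n
    rw [ae_all_iff]
    intro k
    exact h _ (θs n k).2.1
  filter_upwards [hgood] with a ha
  obtain ⟨⟨hva, hvL2⟩, hvan⟩ := ha
  intro θ hθ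
  -- choose the ball containing the support of `θ`
  obtain ⟨r, hr⟩ := hθ.hasCompactSupport.isCompact.isBounded.subset_closedBall (0 : E)
  set n : ℕ := ⌈r⌉₊ with hn
  have hsub : tsupport θ ⊆ closedBall (0 : E) n :=
    hr.trans (closedBall_subset_closedBall (Nat.le_ceil r))
  set θ' : Tn n := ⟨θ, hθ, hsub⟩ with hθ'
  -- `v a ∈ L²(μn n)`
  have hw : MemLp (v a) 2 (μn n) := memLp_two_restrict_of_lintegral_lt_top hva (hvL2 n)
  set w : Lp E 2 (μn n) := hw.toLp with hw_def
  -- the `L²` pairing with `F n θ''` is the whole-space pairing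
  have hpair : ∀ θ'' : Tn n, ⟪w, F n θ''⟫ = ∫ x, ⟪v a x, gradient (θ'' : E → ℝ) x⟫ := by
    intro θ''
    rw [MeasureTheory.L2.inner_def]
    have h1 : ∫ x, ⟪(w : E → E) x, (F n θ'' : E → E) x⟫ ∂(μn n) =
        ∫ x, ⟪v a x, gradient (θ'' : E → ℝ) x⟫ ∂(μn n) := by
      refine integral_congr_ae ?_
      filter_upwards [hw.coeFn_toLp, (hmem n θ'').coeFn_toLp] with x hx1 hx2
      rw [hx1, hx2]
    rw [h1, hμn]
    refine setIntegral_eq_integral_of_forall_compl_eq_zero fun x hx => ?_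
    have hx' : x ∉ tsupport (θ'' : E → ℝ) := fun h' => hx (θ''.2.2 h')
    rw [gradient_eq_zero_of_notMem_tsupport hx', inner_zero_right]
  -- the annihilator of `w` is closed and contains the dense sequence
  set C : Set (Lp E 2 (μn n)) := {g | ⟪w, g⟫ = 0} with hC
  have hCclosed : IsClosed C := isClosed_eq (continuous_const.inner continuous_id) continuous_const
  have hrange : range (fun k => (sq n k : Lp E 2 (μn n))) ⊆ C := by
    rintro _ ⟨k, rfl⟩
    show ⟪w, (sq n k : Lp E 2 (μn n))⟫ = 0
    rw [← hθs n k, hpair, hvan n k]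
  have hmemC : F n θ' ∈ C := by
    have h1 : (⟨F n θ', mem_range_self _⟩ : range (F n)) ∈ closure (range (sq n)) := by
      rw [(hsq_dense n).closure_range]; exact mem_univ _
    have h2 : F n θ' ∈ closure (range fun k => (sq n k : Lp E 2 (μn n))) := by
      have := map_mem_closure continuous_subtype_val h1
        (t := range fun k => (sq n k : Lp E 2 (μn n))) (by
          rintro _ ⟨k, rfl⟩; exact ⟨k, rfl⟩)
      exact this
    exact closure_minimal hrange hCclosed h2
  have := hmemC
  rw [hC, mem_setOf_eq, hpair] at this
  exact this

end AEDivFree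

/-! ### Smooth cut-offs in time and the approximate identity at `t = 0⁺` -/

section Cutoff

/-- **Smooth monotone cut-offs in time.** For `δ > 0` there is a smooth `η : ℝ → ℝ` with
`η = 0` on `(-∞, δ]`, `η = 1` on `[3δ, ∞)`, `0 ≤ η ≤ 1`, whose derivative `ρ = η'` is a
non-negative continuous kernel supported in `(δ, 3δ)` of unit mass (the primitive
`η(s) = ∫_δ^s ρ` of the shifted normalised bump `ρ(s) = φ_δ(2δ - s)`, accepted
`Literature.Analysis.FunctionSpaces.contDiff_primitive_normed` & co.). [folklore] -/
theorem exists_smooth_time_cutoff {δ : ℝ} (hδ : 0 < δ) :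
    ∃ η ρ : ℝ → ℝ, ContDiff ℝ (⊤ : ℕ∞) η ∧ Continuous ρ ∧ (∀ s, HasDerivAt η (ρ s) s) ∧
      (∀ s, s ≤ δ → η s = 0) ∧ (∀ s, 3 * δ ≤ s → η s = 1) ∧ (∀ s, η s ∈ Icc (0 : ℝ) 1) ∧
      (∀ s, 0 ≤ ρ s) ∧ (∀ s, s ∉ Ioo δ (3 * δ) → ρ s = 0) ∧ ∫ s, ρ s = 1 := by
  let φ : ContDiffBump (0 : ℝ) := ⟨δ / 2, δ, half_pos hδ, half_lt_self hδ⟩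
  have hrOut : φ.rOut = δ := rfl
  have hbase : δ ≤ 2 * δ - φ.rOut := by rw [hrOut]; linarith
  refine ⟨fun s => ∫ x in δ..s, φ.normed volume (2 * δ - x), fun s => φ.normed volume (2 * δ - s),
    FunctionSpaces.contDiff_primitive_normed φ δ (2 * δ), (FunctionSpaces.contDiff_normed_comp_sub φ (2 * δ)).continuous,
    fun s => FunctionSpaces.hasDerivAt_primitive_normed φ δ (2 * δ) s,
    fun s hs => FunctionSpaces.primitive_normed_eq_zero φ hbase hs,
    fun s hs => FunctionSpaces.primitive_normed_eq_one φ hbase (by rw [hrOut]; linarith),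
    fun s => FunctionSpaces.primitive_normed_mem_Icc φ hbase s, fun s => φ.nonneg_normed _, fun s hs => ?_,
    FunctionSpaces.integral_normed_comp_sub φ (2 * δ)⟩
  apply FunctionSpaces.normed_comp_sub_eq_zero φ
  rw [hrOut]
  simp only [mem_Ioo, not_and_or, not_lt] at hs
  rcases hs with hs | hs
  · rw [abs_of_nonneg (by linarith)]; linarith
  · rw [abs_of_nonpos (by linarith)]; linarith

/-- A continuous function vanishing off a bounded interval is bounded. [folklore] -/
theorem exists_abs_le_of_eq_zero_off_Ioo {ρ : ℝ → ℝ} (hρ : Continuous ρ) {a b : ℝ}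
    (h0 : ∀ s, s ∉ Ioo a b → ρ s = 0) : ∃ C, 0 ≤ C ∧ ∀ s, |ρ s| ≤ C := by
  obtain ⟨C, hC⟩ := isCompact_Icc.exists_bound_of_continuousOn (hρ.continuousOn (s := Icc a b))
  refine ⟨max C 0, le_max_right _ _, fun s => ?_⟩
  by_cases hs : s ∈ Ioo a b
  · exact le_trans (by simpa [Real.norm_eq_abs] using hC s (Ioo_subset_Icc_self hs))
      (le_max_left _ _)
  · rw [h0 s hs, abs_zero]; exact le_max_right _ _

/-- **Approximate identity at `t = 0⁺` against an a.e. limit.** Let `U` be integrable on `(0, T)`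
with `U(t) → L` as `t → 0⁺` in the a.e. sense (`∀ ε > 0 ∃ τ > 0`, `|U - L| ≤ ε` a.e. on
`(0, τ)`), and let `ρₖ ≥ 0` be continuous unit-mass kernels supported in `(δₖ, 3δₖ) ⊆ (0, T)` with
`δₖ → 0`. Then `∫_{(0,T)} ρₖ U → L`. [folklore] -/
theorem tendsto_setIntegral_mul_of_ae_tendsto {T L : ℝ} {U : ℝ → ℝ}
    (hU : IntegrableOn U (Ioo 0 T))
    (hlim : ∀ ε > 0, ∃ τ > 0, ∀ᵐ t ∂((volume : Measure ℝ).restrict (Ioo 0 τ)), |U t - L| ≤ ε)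
    {ρ : ℕ → ℝ → ℝ} {δ : ℕ → ℝ} (hδ : Tendsto δ atTop (𝓝 0)) (hδ0 : ∀ k, 0 < δ k)
    (hδT : ∀ k, 3 * δ k ≤ T) (hρc : ∀ k, Continuous (ρ k)) (hρ0 : ∀ k s, 0 ≤ ρ k s)
    (hρsupp : ∀ k s, s ∉ Ioo (δ k) (3 * δ k) → ρ k s = 0) (hρ1 : ∀ k, ∫ s, ρ k s = 1) :
    Tendsto (fun k => ∫ t in Ioo 0 T, ρ k t * U t) atTop (𝓝 L) := by
  rw [Metric.tendsto_atTop]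
  intro ε hε
  obtain ⟨τ, hτ, hae⟩ := hlim (ε / 2) (half_pos hε)
  have hev : ∀ᶠ k in atTop, 3 * δ k < τ := by
    have h3 : Tendsto (fun k => 3 * δ k) atTop (𝓝 (3 * 0)) := hδ.const_mul 3
    rw [mul_zero] at h3
    exact (tendsto_order.1 h3).2 τ hτ
  obtain ⟨N, hN⟩ := eventually_atTop.1 hev
  refine ⟨N, fun k hk => ?_⟩
  have hk' : 3 * δ k < τ := hN k hk
  obtain ⟨C, hC0, hC⟩ := exists_abs_le_of_eq_zero_off_Ioo (hρc k) (hρsupp k)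
  have hρT : ∫ t in Ioo 0 T, ρ k t = 1 := by
    rw [setIntegral_eq_integral_of_forall_compl_eq_zero, hρ1 k]
    intro t ht
    apply hρsupp
    intro h'
    exact ht ⟨(hδ0 k).trans h'.1, h'.2.trans_le (hδT k)⟩
  have hρint : IntegrableOn (ρ k) (Ioo 0 T) :=
    ((hρc k).integrableOn_Icc (a := 0) (b := T)).mono_set Ioo_subset_Icc_self
  have hρU : IntegrableOn (fun t => ρ k t * U t) (Ioo 0 T) := by
    refine Integrable.mono' (hU.norm.const_mul C)
      ((hρc k).aestronglyMeasurable.restrict.mul hU.1) ?_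
    filter_upwards with t
    rw [norm_mul]
    exact mul_le_mul_of_nonneg_right (by simpa [Real.norm_eq_abs] using hC t) (norm_nonneg _)
  have hdiff : (∫ t in Ioo 0 T, ρ k t * U t) - L = ∫ t in Ioo 0 T, ρ k t * (U t - L) := by
    have hL : L = ∫ t in Ioo 0 T, ρ k t * L := by rw [integral_mul_const, hρT, one_mul]
    conv_lhs => rw [hL]
    rw [← integral_sub hρU (hρint.mul_const L)]
    congr 1
    ext t
    ring
  rw [Real.dist_eq, hdiff]
  have hpt : ∀ᵐ t ∂((volume : Measure ℝ).restrict (Ioo 0 T)),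
      ‖ρ k t * (U t - L)‖ ≤ ρ k t * (ε / 2) := by
    have hae' : ∀ᵐ t ∂(volume : Measure ℝ), t ∈ Ioo 0 τ → |U t - L| ≤ ε / 2 :=
      (ae_restrict_iff' measurableSet_Ioo).1 hae
    filter_upwards [ae_restrict_of_ae (s := Ioo 0 T) hae'] with t ht
    rw [norm_mul, Real.norm_eq_abs, Real.norm_eq_abs, abs_of_nonneg (hρ0 k t)]
    by_cases hts : t ∈ Ioo (δ k) (3 * δ k)
    · exact mul_le_mul_of_nonneg_left (ht ⟨(hδ0 k).trans hts.1, hts.2.trans hk'⟩) (hρ0 k t)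
    · rw [hρsupp k t hts, zero_mul, zero_mul]
  calc |∫ t in Ioo 0 T, ρ k t * (U t - L)|
      ≤ ∫ t in Ioo 0 T, ρ k t * (ε / 2) := by
        rw [← Real.norm_eq_abs]
        exact norm_integral_le_of_norm_le (hρint.mul_const _) hpt
    _ = ε / 2 := by rw [integral_mul_const, hρT, one_mul]
    _ < ε := half_lt_self hε

end Cutoff

/-! ### Test-field algebra: products with functions of time -/

section TestAlgebra

variable {X : Type*} [NormedAddCommGroup X] [NormedSpace ℝ X]
variable {F : Type*} [NormedAddCommGroup F] [NormedSpace ℝ F]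

/-- The product `η(s) θ(x)` of a smooth compactly supported `η` with `supp η ⊆ I` (`I` open) and a
test function `θ` on `X` is a space–time test field on the slab `I × X`. [folklore] -/
theorem isSpaceTimeTestOn_slab_smul {I : Set ℝ} (hI : IsOpen I) {η : ℝ → ℝ}
    (hη : ContDiff ℝ (⊤ : ℕ∞) η) (hηc : HasCompactSupport η) (hηI : tsupport η ⊆ I) {θ : X → F}
    (hθ : FunctionSpaces.IsTestFunctionOn (⊤ : Opens X) θ) :
    IsSpaceTimeTestOn (slab X I hI) (fun s x => η s • θ x) where
  contDiff := (hη.comp contDiff_fst).smul (hθ.contDiff.comp contDiff_snd)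
  hasCompactSupport := by
    refine HasCompactSupport.intro (hηc.prod hθ.hasCompactSupport) ?_
    rintro ⟨s, x⟩ hp
    rcases not_and_or.1 (fun h => hp (mem_prod.2 h)) with h | h
    · simp [uncurry, image_eq_zero_of_notMem_tsupport h]
    · simp [uncurry, image_eq_zero_of_notMem_tsupport h]
  tsupport_subset := by
    intro p hp
    have hp' : p.1 ∈ tsupport η := by
      have h1 : p ∈ tsupport fun z : ℝ × X => η z.1 :=
        tsupport_smul_subset_left (fun z : ℝ × X => η z.1) (fun z => θ z.2) hp
      have h2 : (tsupport fun z : ℝ × X => η z.1) ⊆ Prod.fst ⁻¹' tsupport η :=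
        closure_minimal (fun z hz => subset_tsupport _ hz)
          ((isClosed_tsupport η).preimage continuous_fst)
      exact h2 h1
    exact mem_slab.2 (hηI hp')

/-- **Time cut-off of a test field.** If `ψ` is a test field on `(-∞, T) × X` and `η` is smooth
with `η = 0` on `(-∞, a]` for some `a > 0`, then `η(t) ψ(t, x)` is a test field on the open slab
`(0, T) × X`. [folklore] -/
theorem IsSpaceTimeTestOn.cutoff {T a : ℝ} (ha : 0 < a) {ψ : ℝ → X → F}
    (hψ : IsSpaceTimeTestOn (slab X (Iio T) isOpen_Iio) ψ) {η : ℝ → ℝ}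
    (hη : ContDiff ℝ (⊤ : ℕ∞) η) (hη0 : ∀ s, s ≤ a → η s = 0) :
    IsSpaceTimeTestOn (slab X (Ioo 0 T) isOpen_Ioo) (fun s x => η s • ψ s x) where
  contDiff := (hη.comp contDiff_fst).smul hψ.contDiff
  hasCompactSupport := by
    have : uncurry (fun s x => η s • ψ s x) = fun z : ℝ × X => η z.1 • uncurry ψ z := rfl
    rw [this]
    exact hψ.hasCompactSupport.smul_left
  tsupport_subset := by
    intro p hp
    have h1 : p ∈ tsupport (uncurry ψ) :=
      tsupport_smul_subset_right (fun z : ℝ × X => η z.1) (uncurry ψ) hp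
    have hT : p.1 < T := mem_slab.1 (hψ.tsupport_subset h1)
    have h2 : p.1 ∈ tsupport η := by
      have h3 : p ∈ tsupport fun z : ℝ × X => η z.1 :=
        tsupport_smul_subset_left (fun z : ℝ × X => η z.1) (uncurry ψ) hp
      have h3' : (tsupport fun z : ℝ × X => η z.1) ⊆ Prod.fst ⁻¹' tsupport η :=
        closure_minimal (fun z hz => subset_tsupport η hz)
          ((isClosed_tsupport η).preimage continuous_fst)
      exact h3' h3
    have h4 : tsupport η ⊆ Ici a := by
      refine closure_minimal (fun s hs => ?_) isClosed_Ici
      by_contra h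
      exact hs (hη0 s (not_le.1 h).le)
    exact mem_slab.2 ⟨ha.trans_le (h4 h2), hT⟩

omit [NormedAddCommGroup X] [NormedSpace ℝ X] in
/-- Time derivative of a cut-off test field: `∂ₜ(η ψ) = η' ψ + η ∂ₜψ`. [folklore] -/
theorem timeDeriv_cutoff {ψ : ℝ → X → F} {η ρ : ℝ → ℝ} (hη : ∀ s, HasDerivAt η (ρ s) s)
    (hψd : ∀ t x, HasDerivAt (fun s => ψ s x) (timeDeriv ψ t x) t) (t : ℝ) (x : X) :
    timeDeriv (fun s y => η s • ψ s y) t x = ρ t • ψ t x + η t • timeDeriv ψ t x := by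
  rw [timeDeriv_apply]
  have h := (hη t).smul (hψd t x)
  rw [show ((η • fun s => ψ s x) : ℝ → F) = fun s => η s • ψ s x from rfl] at h
  rw [h.deriv, add_comm]

end TestAlgebra

section SliceAlgebra

variable {E : Type*} [NormedAddCommGroup E] [InnerProductSpace ℝ E] [FiniteDimensional ℝ E]
variable {F' : Type*} [NormedAddCommGroup F'] [InnerProductSpace ℝ F']

omit [FiniteDimensional ℝ E] in
/-- `(u·∇)(c w) = c (u·∇)w` for a constant `c`. [folklore] -/
theorem convect_fun_const_smul (u : E → E) {w : E → F'} {x : E} (hw : DifferentiableAt ℝ w x)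
    (c : ℝ) : convect u (fun y => c • w y) x = c • convect u w x := by
  simp [convect, fderiv_fun_const_smul hw c]

/-- `Δ (c w) = c Δ w` for a constant `c` and a `C²` field. [folklore] -/
theorem laplacian_fun_const_smul {w : E → F'} (hw : ContDiff ℝ 2 w) (c : ℝ) (x : E) :
    (Δ fun y => c • w y) x = c • (Δ w) x :=
  laplacian_smul c hw.contDiffAt

omit [FiniteDimensional ℝ E] in
/-- `div (c v) = c div v` for a constant `c`. [folklore] -/
theorem divergence_fun_const_smul {v : E → E} {x : E} (hv : DifferentiableAt ℝ v x) (c : ℝ) :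
    VectorCalculus.divergence (fun y => c • v y) x = c * VectorCalculus.divergence v x := by
  simp [VectorCalculus.divergence, fderiv_fun_const_smul hv c]

end SliceAlgebra

/-! ### Integrability on the open slab `(0, T) × E` -/

section Slab

variable {E : Type*} [NormedAddCommGroup E] [InnerProductSpace ℝ E] [FiniteDimensional ℝ E]
  [MeasurableSpace E] [BorelSpace E]
variable {F' : Type*} [NormedAddCommGroup F'] [InnerProductSpace ℝ F']
variable {T : ℝ}

/-- The volume on the open slab `(0,T) × E` is the product `dt|_(0,T) ⊗ dx`. [folklore] -/
theorem volume_restrict_slab_eq (T : ℝ) :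
    (volume : Measure (ℝ × E)).restrict (Ioo 0 T ×ˢ univ) =
      ((volume : Measure ℝ).restrict (Ioo 0 T)).prod (volume : Measure E) := by
  rw [Measure.volume_eq_prod, Measure.restrict_prod_eq_prod_univ]

/-- The finite cylinder `(0,T) × K`, `K` compact, has finite volume. [folklore] -/
theorem volume_Ioo_prod_lt_top {K : Set E} (hK : IsCompact K) :
    (volume : Measure (ℝ × E)) (Ioo 0 T ×ˢ K) < ∞ := by
  rw [Measure.volume_eq_prod, Measure.prod_prod]
  exact ENNReal.mul_lt_top measure_Ioo_lt_top hK.measure_lt_top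

omit [InnerProductSpace ℝ F'] in
/-- **`L²` on a finite cylinder is `L¹`.** A field which is a.e.-strongly measurable and has
`∫⁻ ‖v‖² < ∞` on `(0,T) × K` is integrable there together with `‖v‖²`. [folklore] -/
theorem integrableOn_cylinder_of_lintegral_sq {v : ℝ × E → F'} {K : Set E} (hK : IsCompact K)
    (hv : AEStronglyMeasurable v ((volume : Measure (ℝ × E)).restrict (Ioo 0 T ×ˢ K)))
    (h2 : ∫⁻ z in Ioo 0 T ×ˢ K, ‖v z‖ₑ ^ 2 < ∞) :
    IntegrableOn v (Ioo 0 T ×ˢ K) volume ∧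
      IntegrableOn (fun z => ‖v z‖ ^ 2) (Ioo 0 T ×ˢ K) volume := by
  haveI : IsFiniteMeasure ((volume : Measure (ℝ × E)).restrict (Ioo 0 T ×ˢ K)) :=
    ⟨by rw [Measure.restrict_apply_univ]; exact volume_Ioo_prod_lt_top hK⟩
  have hmem : MemLp v 2 ((volume : Measure (ℝ × E)).restrict (Ioo 0 T ×ˢ K)) := by
    refine ⟨hv, ?_⟩
    rw [eLpNorm_lt_top_iff_lintegral_rpow_enorm_lt_top two_ne_zero ENNReal.ofNat_ne_top]
    simpa [ENNReal.toReal_ofNat] using h2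
  exact ⟨hmem.integrable one_le_two, (memLp_two_iff_integrable_sq_norm hv).1 hmem⟩

omit [InnerProductSpace ℝ E] [FiniteDimensional ℝ E] [MeasurableSpace E] [BorelSpace E] in
/-- A continuous field on `ℝ × E` vanishing for `x` outside a compact `K` is bounded on
`(0, T) × E`. [folklore] -/
theorem exists_norm_le_of_continuous_of_eq_zero {G : Type*} [NormedAddCommGroup G]
    {Ψ : ℝ × E → G} {K : Set E} (hK : IsCompact K) (hΨ : Continuous Ψ)
    (hΨK : ∀ t x, x ∉ K → Ψ (t, x) = 0) (T : ℝ) :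
    ∃ C, 0 ≤ C ∧ ∀ z ∈ Ioo 0 T ×ˢ (univ : Set E), ‖Ψ z‖ ≤ C := by
  obtain ⟨C, hC⟩ := (isCompact_Icc.prod hK).exists_bound_of_continuousOn
    (hΨ.continuousOn (s := Icc 0 T ×ˢ K))
  refine ⟨max C 0, le_max_right _ _, fun z hz => ?_⟩
  by_cases h : z.2 ∈ K
  · exact (hC z ⟨Ioo_subset_Icc_self hz.1, h⟩).trans (le_max_left _ _)
  · obtain ⟨t, x⟩ := z
    rw [hΨK t x h, norm_zero]
    exact le_max_right _ _

/-- **Pairings on the slab are integrable.** If `v` is integrable on `(0,T) × K` and `Ψ` is a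
continuous field vanishing for `x ∉ K`, then `⟪v, Ψ⟫` is integrable for `dt|_(0,T) ⊗ dx`.
[folklore] -/
theorem integrable_slab_inner {v Ψ : ℝ × E → F'} {K : Set E} (hK : IsCompact K)
    (hv : IntegrableOn v (Ioo 0 T ×ˢ K) volume) (hΨ : Continuous Ψ)
    (hΨK : ∀ t x, x ∉ K → Ψ (t, x) = 0) :
    Integrable (fun z => ⟪v z, Ψ z⟫)
      (((volume : Measure ℝ).restrict (Ioo 0 T)).prod (volume : Measure E)) := by
  obtain ⟨C, hC0, hC⟩ := exists_norm_le_of_continuous_of_eq_zero hK hΨ hΨK T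
  rw [← volume_restrict_slab_eq]
  have h1 : IntegrableOn (fun z => ⟪v z, Ψ z⟫) (Ioo 0 T ×ˢ K) volume := by
    refine Integrable.mono' (hv.norm.mul_const C) (hv.1.inner hΨ.aestronglyMeasurable) ?_
    filter_upwards [ae_restrict_mem (measurableSet_Ioo.prod hK.measurableSet)] with z hz
    exact (norm_inner_le_norm _ _).trans
      (mul_le_mul_of_nonneg_left (hC z ⟨hz.1, mem_univ _⟩) (norm_nonneg _))
  refine h1.of_forall_sdiff_eq_zero (measurableSet_Ioo.prod MeasurableSet.univ) fun z hz => ?_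
  have hz2 : z.2 ∉ K := fun h => hz.2 ⟨hz.1.1, h⟩
  obtain ⟨t, x⟩ := z
  rw [hΨK t x hz2, inner_zero_right]

/-- **The quadratic pairing on the slab is integrable.** If `v` and `‖v‖²` are integrable on
`(0,T) × K` and `A` is a continuous operator field vanishing for `x ∉ K`, then `⟪v, A v⟫` is
integrable for `dt|_(0,T) ⊗ dx`. [folklore] -/
theorem integrable_slab_inner_clm_apply {v : ℝ × E → F'} {A : ℝ × E → F' →L[ℝ] F'} {K : Set E}
    (hK : IsCompact K) (hv : IntegrableOn v (Ioo 0 T ×ˢ K) volume)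
    (hv2 : IntegrableOn (fun z => ‖v z‖ ^ 2) (Ioo 0 T ×ˢ K) volume) (hA : Continuous A)
    (hAK : ∀ t x, x ∉ K → A (t, x) = 0) :
    Integrable (fun z => ⟪v z, A z (v z)⟫)
      (((volume : Measure ℝ).restrict (Ioo 0 T)).prod (volume : Measure E)) := by
  obtain ⟨C, hC0, hC⟩ := exists_norm_le_of_continuous_of_eq_zero hK hA hAK T
  rw [← volume_restrict_slab_eq]
  have hm : AEStronglyMeasurable (fun z => ⟪v z, A z (v z)⟫)
      ((volume : Measure (ℝ × E)).restrict (Ioo 0 T ×ˢ K)) :=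
    hv.1.inner (isBoundedBilinearMap_apply.continuous.comp_aestronglyMeasurable
      (hA.aestronglyMeasurable.prodMk hv.1))
  have h1 : IntegrableOn (fun z => ⟪v z, A z (v z)⟫) (Ioo 0 T ×ˢ K) volume := by
    refine Integrable.mono' (hv2.const_mul C) hm ?_
    filter_upwards [ae_restrict_mem (measurableSet_Ioo.prod hK.measurableSet)] with z hz
    calc ‖⟪v z, A z (v z)⟫‖ ≤ ‖v z‖ * ‖A z (v z)‖ := norm_inner_le_norm _ _
      _ ≤ ‖v z‖ * (C * ‖v z‖) := by
          gcongr
          exact (ContinuousLinearMap.le_opNorm _ _).trans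
            (mul_le_mul_of_nonneg_right (hC z ⟨hz.1, mem_univ _⟩) (norm_nonneg _))
      _ = C * ‖v z‖ ^ 2 := by ring
  refine h1.of_forall_sdiff_eq_zero (measurableSet_Ioo.prod MeasurableSet.univ) fun z hz => ?_
  have hz2 : z.2 ∉ K := fun h => hz.2 ⟨hz.1.1, h⟩
  obtain ⟨t, x⟩ := z
  simp [hAK t x hz2]

/-- Multiplying an integrable space–time integrand by a bounded continuous function of time keeps
it integrable. [folklore] -/
theorem integrable_time_mul {μ : Measure (ℝ × E)} {G : ℝ × E → ℝ}
    (hG : Integrable G μ) {η : ℝ → ℝ} (hη : Continuous η) {C : ℝ} (hC : ∀ s, |η s| ≤ C) :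
    Integrable (fun z => η z.1 * G z) μ := by
  refine Integrable.mono' (hG.norm.const_mul C)
    ((hη.comp continuous_fst).aestronglyMeasurable.mul hG.1) ?_
  filter_upwards with z
  rw [norm_mul, Real.norm_eq_abs]
  exact mul_le_mul_of_nonneg_right (hC z.1) (norm_nonneg _)

end Slab

/-! ### From the hypotheses of the fact: cylinders, slices, test-wise divergence -/

section Hyp

variable {E : Type*} [NormedAddCommGroup E] [InnerProductSpace ℝ E] [FiniteDimensional ℝ E]
  [MeasurableSpace E] [BorelSpace E]
variable {T : ℝ} {u : ℝ → E → E} {u₀ : E → E}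

/-- `u ∈ L²((0,T) × K)` for every compact `K` (hypothesis `hu` of the fact) and measurability on
the slab give integrability of `u` and `‖u‖²` on every finite cylinder. [folklore] -/
theorem integrableOn_cylinder_of_lintegral_sq_slab
    (hmeas : AEStronglyMeasurable (uncurry u)
      ((volume : Measure (ℝ × E)).restrict (Ioo 0 T ×ˢ univ)))
    (hu : ∀ K : Set E, IsCompact K → ∫⁻ z in Ioo 0 T ×ˢ K, ‖uncurry u z‖ₑ ^ 2 < ∞)
    {K : Set E} (hK : IsCompact K) :
    IntegrableOn (uncurry u) (Ioo 0 T ×ˢ K) volume ∧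
      IntegrableOn (fun z => ‖uncurry u z‖ ^ 2) (Ioo 0 T ×ˢ K) volume :=
  integrableOn_cylinder_of_lintegral_sq hK
    (hmeas.mono_measure (Measure.restrict_mono (prod_mono Subset.rfl (subset_univ K)) le_rfl))
    (hu K hK)

/-- **Almost every time slice is measurable and locally square integrable** (Tonelli on the
cylinders `(0,T) × B̄(0,n)`, `n ∈ ℕ`). [folklore] -/
theorem ae_slice_aestronglyMeasurable_and_lintegral_ball_lt_top
    (hmeas : AEStronglyMeasurable (uncurry u)
      ((volume : Measure (ℝ × E)).restrict (Ioo 0 T ×ˢ univ)))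
    (hu : ∀ K : Set E, IsCompact K → ∫⁻ z in Ioo 0 T ×ˢ K, ‖uncurry u z‖ₑ ^ 2 < ∞) :
    ∀ᵐ t ∂((volume : Measure ℝ).restrict (Ioo 0 T)),
      AEStronglyMeasurable (u t) (volume : Measure E) ∧
        ∀ n : ℕ, ∫⁻ x in closedBall (0 : E) n, ‖u t x‖ₑ ^ 2 < ∞ := by
  rw [volume_restrict_slab_eq] at hmeas
  have h1 : ∀ᵐ t ∂((volume : Measure ℝ).restrict (Ioo 0 T)),
      AEStronglyMeasurable (fun x => uncurry u (t, x)) (volume : Measure E) := hmeas.prodMk_left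
  have h2 : ∀ n : ℕ, ∀ᵐ t ∂((volume : Measure ℝ).restrict (Ioo 0 T)),
      ∫⁻ x in closedBall (0 : E) n, ‖u t x‖ₑ ^ 2 < ∞ := by
    intro n
    have hK : IsCompact (closedBall (0 : E) n) := isCompact_closedBall _ _
    have hfin := hu _ hK
    rw [show (volume : Measure (ℝ × E)).restrict (Ioo 0 T ×ˢ closedBall (0 : E) n) =
        ((volume : Measure ℝ).restrict (Ioo 0 T)).prod
          ((volume : Measure E).restrict (closedBall (0 : E) n)) by
      rw [Measure.volume_eq_prod, Measure.prod_restrict]] at hfin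
    have hle : ((volume : Measure ℝ).restrict (Ioo 0 T)).prod
        ((volume : Measure E).restrict (closedBall (0 : E) n)) ≤
        ((volume : Measure ℝ).restrict (Ioo 0 T)).prod (volume : Measure E) :=
      Measure.prod_mono le_rfl Measure.restrict_le_self
    have hm : AEMeasurable (fun z : ℝ × E => ‖uncurry u z‖ₑ ^ 2)
        (((volume : Measure ℝ).restrict (Ioo 0 T)).prod
          ((volume : Measure E).restrict (closedBall (0 : E) n))) :=
      ((hmeas.mono_measure hle).aemeasurable.enorm.pow_const 2)
    rw [lintegral_prod _ hm] at hfin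
    filter_upwards [ae_lt_top' hm.lintegral_prod_right' hfin.ne] with t ht
    exact ht
  rw [← ae_all_iff] at h2
  filter_upwards [h1, h2] with t h1t h2t
  exact ⟨h1t, h2t⟩

/-- **Test-wise a.e. vanishing of the divergence.** If `∫∫ ⟪u, ∇ₓΘ⟫ = 0` for every space–time
test `Θ` on the slab `(0,T) × E`, then for every test function `θ` on `E` the pairing
`∫ ⟪u(t), ∇θ⟫` vanishes for a.e. `t ∈ (0,T)`: test with `Θ = η ⊗ θ`, `η ∈ C_c^∞((0,T))`, use
Fubini, and the fundamental lemma of the calculus of variations in `t` (Mathlib's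
`IsOpen.ae_eq_zero_of_integral_contDiff_smul_eq_zero`). [folklore] -/
private theorem ae_integral_inner_gradient_eq_zero
    (hdiv : ∀ θ : ℝ → E → ℝ, IsSpaceTimeTestOn (slab E (Ioo 0 T) isOpen_Ioo) θ →
      ∫ z in Ioo 0 T ×ˢ (univ : Set E), ⟪u z.1 z.2, gradient (θ z.1) z.2⟫ = 0)
    (hUK : ∀ K : Set E, IsCompact K → IntegrableOn (uncurry u) (Ioo 0 T ×ˢ K) volume)
    {θ : E → ℝ} (hθ : FunctionSpaces.IsTestFunctionOn (⊤ : Opens E) θ) :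
    ∀ᵐ t ∂((volume : Measure ℝ).restrict (Ioo 0 T)), ∫ x, ⟪u t x, gradient θ x⟫ = 0 := by
  set K := tsupport θ with hK_def
  have hK : IsCompact K := hθ.hasCompactSupport
  have hθd : Differentiable ℝ θ := hθ.contDiff.differentiable (by simp)
  have hgc : Continuous (gradient θ) :=
    continuous_gradient_of_contDiff (contDiff_infty.1 hθ.contDiff 1)
  have hg0 : ∀ (t : ℝ) (x : E), x ∉ K → gradient θ x = 0 := fun _ x hx =>
    gradient_eq_zero_of_notMem_tsupport hx
  have hG : Integrable (fun z : ℝ × E => ⟪uncurry u z, gradient θ z.2⟫)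
      (((volume : Measure ℝ).restrict (Ioo 0 T)).prod (volume : Measure E)) :=
    integrable_slab_inner hK (hUK K hK) (hgc.comp continuous_snd) hg0
  have hg : Integrable (fun t => ∫ x, ⟪u t x, gradient θ x⟫)
      ((volume : Measure ℝ).restrict (Ioo 0 T)) := hG.integral_prod_left
  have key := IsOpen.ae_eq_zero_of_integral_contDiff_smul_eq_zero isOpen_Ioo
    (μ := (volume : Measure ℝ)) (f := fun t => ∫ x, ⟪u t x, gradient θ x⟫)
    (IntegrableOn.locallyIntegrableOn hg) ?_
  · exact (ae_restrict_iff' measurableSet_Ioo).2 key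
  intro η hη hηc hηI
  obtain ⟨C, hC⟩ := hη.continuous.bounded_above_of_compact_support hηc
  have hC' : ∀ s, |η s| ≤ C := fun s => by simpa [Real.norm_eq_abs] using hC s
  have hΘ : IsSpaceTimeTestOn (slab E (Ioo 0 T) isOpen_Ioo) (fun s x => η s • θ x) :=
    isSpaceTimeTestOn_slab_smul isOpen_Ioo hη hηc hηI hθ
  have h0 := hdiv _ hΘ
  have hgrad : ∀ s x, gradient (fun x => η s • θ x) x = η s • gradient θ x := by
    intro s x
    rw [gradient, gradient, show (fun x => η s • θ x) = fun x => η s * θ x from rfl,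
      fderiv_const_mul (hθd x), map_smul]
  simp_rw [hgrad, real_inner_smul_right] at h0
  have hG' : Integrable (fun z : ℝ × E => η z.1 * ⟪u z.1 z.2, gradient θ z.2⟫)
      (((volume : Measure ℝ).restrict (Ioo 0 T)).prod (volume : Measure E)) :=
    integrable_time_mul hG hη.continuous hC'
  rw [volume_restrict_slab_eq, integral_prod _ hG'] at h0
  simp_rw [integral_const_mul] at h0
  -- `h0 : ∫ t in (0,T), η t * ∫ ⟪u t, ∇θ⟫ = 0`; outside `(0, T)` the integrand vanishes
  rw [← setIntegral_eq_integral_of_forall_compl_eq_zero (s := Ioo 0 T)]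
  · simpa only [smul_eq_mul] using h0
  · intro t ht
    rw [image_eq_zero_of_notMem_tsupport (fun h => ht (hηI h)), zero_smul]

/-- **The datum is locally square integrable** (given `T > 0`): pick a good time `t` close to
`0` with `u(t) ∈ L²(K)` and `‖u(t) - u₀‖_{L²(K)} < 1`; then `u₀ = u(t) - (u(t) - u₀) ∈ L²(K)`.
Measurability of `u₀` is essential here. [folklore] -/
theorem lintegral_datum_sq_lt_top (hT : 0 < T) {K : Set E}
    (hgood : ∀ᵐ t ∂((volume : Measure ℝ).restrict (Ioo 0 T)),
      AEStronglyMeasurable (u t) (volume : Measure E) ∧ ∫⁻ x in K, ‖u t x‖ₑ ^ 2 < ∞)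
    (hm₀ : AEStronglyMeasurable u₀ (volume : Measure E))
    (h₀ : Tendsto (fun t => ∫⁻ x in K, ‖u t x - u₀ x‖ₑ ^ 2) (𝓝[>] 0) (𝓝 0)) :
    ∫⁻ x in K, ‖u₀ x‖ₑ ^ 2 < ∞ := by
  have hev : ∀ᶠ t in 𝓝[>] (0 : ℝ), ∫⁻ x in K, ‖u t x - u₀ x‖ₑ ^ 2 < 1 :=
    h₀.eventually (gt_mem_nhds one_pos)
  obtain ⟨τ, hτ, hsub⟩ := mem_nhdsGT_iff_exists_Ioo_subset.1 hev
  set τ' := min τ T with hτ'_def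
  have hτ' : 0 < τ' := lt_min hτ hT
  have hgood' : ∀ᵐ t ∂((volume : Measure ℝ).restrict (Ioo 0 τ')),
      (AEStronglyMeasurable (u t) (volume : Measure E) ∧ ∫⁻ x in K, ‖u t x‖ₑ ^ 2 < ∞) ∧
        t ∈ Ioo 0 τ' :=
    (ae_restrict_of_ae_restrict_of_subset (Ioo_subset_Ioo_right (min_le_right _ _)) hgood).and
      (ae_restrict_mem measurableSet_Ioo)
  have hne : (volume : Measure ℝ).restrict (Ioo 0 τ') ≠ 0 := by
    rw [Ne, Measure.restrict_eq_zero, Real.volume_Ioo, ENNReal.ofReal_eq_zero, not_le]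
    linarith
  haveI : (ae ((volume : Measure ℝ).restrict (Ioo 0 τ'))).NeBot := ae_neBot.2 hne
  obtain ⟨t, ⟨hmt, hfin⟩, ht⟩ := hgood'.exists
  have hdist : ∫⁻ x in K, ‖u t x - u₀ x‖ₑ ^ 2 < 1 :=
    hsub ⟨ht.1, ht.2.trans_le (min_le_left _ _)⟩
  have h1 : MemLp (u t) 2 ((volume : Measure E).restrict K) :=
    memLp_two_restrict_of_lintegral_lt_top hmt hfin
  have h2 : MemLp (fun x => u t x - u₀ x) 2 ((volume : Measure E).restrict K) :=
    memLp_two_restrict_of_lintegral_lt_top (hmt.sub hm₀) (hdist.trans ENNReal.one_lt_top)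
  have h3 : MemLp u₀ 2 ((volume : Measure E).restrict K) := by
    have h12 := h1.sub h2
    have heq : ((u t) - fun x => u t x - u₀ x) = u₀ := by
      ext x
      simp
    rwa [heq] at h12
  have h4 := h3.2
  rw [eLpNorm_lt_top_iff_lintegral_rpow_enorm_lt_top two_ne_zero ENNReal.ofNat_ne_top] at h4
  simpa [ENNReal.toReal_ofNat] using h4

/-- **The pairing with a test field is right-continuous at `t = 0⁺` in the a.e. sense.**
If `u(t) → u₀` in `L²(K)` as `t → 0⁺`, `u₀ ∈ L²(K)` is measurable, a.e. slice `u(t)` is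
measurable and in `L²(K)`, and `ψ` is a continuous compactly supported field vanishing for
`x ∉ K`, then for every `ε > 0` there is `τ > 0` with
`|∫ ⟪u(t), ψ(t)⟫ - ∫ ⟪u₀, ψ(0)⟫| ≤ ε` for a.e. `t ∈ (0, τ)`:
`∫ ⟪u(t), ψ(t)⟫ - ∫ ⟪u₀, ψ(0)⟫ = ∫ ⟪u(t) - u₀, ψ(t)⟫ + ∫ ⟪u₀, ψ(t) - ψ(0)⟫`, the first term is
`≤ ‖u(t) - u₀‖_{L²(K)} ‖ψ(t)‖_{L²(K)}` (Cauchy–Schwarz) and the second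
`≤ ‖u₀‖_{L¹(K)} sup |ψ(t) - ψ(0)|` (uniform continuity of `ψ`). [folklore] -/
theorem exists_ae_abs_pairing_sub_datum_le (hT : 0 < T) {K : Set E} (hK : IsCompact K)
    (hgood : ∀ᵐ t ∂((volume : Measure ℝ).restrict (Ioo 0 T)),
      AEStronglyMeasurable (u t) (volume : Measure E) ∧ ∫⁻ x in K, ‖u t x‖ₑ ^ 2 < ∞)
    (hm₀ : AEStronglyMeasurable u₀ (volume : Measure E)) (hu₀ : ∫⁻ x in K, ‖u₀ x‖ₑ ^ 2 < ∞)
    (h₀ : Tendsto (fun t => ∫⁻ x in K, ‖u t x - u₀ x‖ₑ ^ 2) (𝓝[>] 0) (𝓝 0))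
    {ψ : ℝ → E → E} (hψc : Continuous (uncurry ψ)) (hψs : HasCompactSupport (uncurry ψ))
    (hψK : ∀ t x, x ∉ K → ψ t x = 0) {ε : ℝ} (hε : 0 < ε) :
    ∃ τ > 0, ∀ᵐ t ∂((volume : Measure ℝ).restrict (Ioo 0 τ)),
      |(∫ x, ⟪u t x, ψ t x⟫) - ∫ x, ⟪u₀ x, ψ 0 x⟫| ≤ ε := by
  set μK : Measure E := (volume : Measure E).restrict K with hμK
  haveI : IsFiniteMeasure μK :=
    ⟨by rw [hμK, Measure.restrict_apply_univ]; exact hK.measure_lt_top⟩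
  -- sup bound of `ψ`
  obtain ⟨Cψ, hCψ⟩ := hψc.bounded_above_of_compact_support hψs
  have hCψ' : ∀ t x, ‖ψ t x‖ ≤ Cψ := fun t x => hCψ (t, x)
  -- `u₀ ∈ L²(K) ⊆ L¹(K)`
  have hm₀K : MemLp u₀ 2 μK := memLp_two_restrict_of_lintegral_lt_top hm₀ hu₀
  have hi₀ : Integrable u₀ μK := hm₀K.integrable one_le_two
  set I₀ : ℝ := ∫ x, ‖u₀ x‖ ∂μK with hI₀_def
  have hI₀ : 0 ≤ I₀ := integral_nonneg fun _ => norm_nonneg _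
  -- uniform continuity of `ψ` in time
  set ε₁ : ℝ := ε / (2 * (I₀ + 1)) with hε₁
  have hε₁0 : 0 < ε₁ := by positivity
  obtain ⟨d, hd, hdψ⟩ : ∃ d > 0, ∀ t x, |t| < d → ‖ψ t x - ψ 0 x‖ ≤ ε₁ := by
    have huc := hψs.uniformContinuous_of_continuous hψc
    obtain ⟨d, hd, h⟩ := Metric.uniformContinuous_iff.1 huc ε₁ hε₁0
    refine ⟨d, hd, fun t x ht => ?_⟩
    have hdist : dist (t, x) ((0 : ℝ), x) < d := by
      rw [Prod.dist_eq, dist_self, Real.dist_eq, sub_zero, max_eq_left (abs_nonneg _)]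
      exact ht
    have := h hdist
    rw [dist_eq_norm] at this
    exact this.le
  -- the Cauchy–Schwarz bound tends to `0`
  set S : ℝ≥0∞ := μK univ ^ (2 : ℝ≥0∞).toReal⁻¹ * ENNReal.ofReal Cψ with hS
  have hS_top : S ≠ ∞ :=
    ENNReal.mul_ne_top (ENNReal.rpow_ne_top_of_nonneg (by positivity) (measure_ne_top _ _))
      ENNReal.ofReal_ne_top
  have hψS : ∀ t, eLpNorm (ψ t) 2 μK ≤ S := fun t =>
    eLpNorm_le_of_ae_bound (Eventually.of_forall fun x => hCψ' t x)
  have hcs : Tendsto (fun t => (∫⁻ x in K, ‖u t x - u₀ x‖ₑ ^ 2) ^ (1 / 2 : ℝ) * S)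
      (𝓝[>] 0) (𝓝 0) := by
    have h1 : Tendsto (fun t => (∫⁻ x in K, ‖u t x - u₀ x‖ₑ ^ 2) ^ (1 / 2 : ℝ))
        (𝓝[>] 0) (𝓝 0) := by
      have := h₀.ennrpow_const (1 / 2 : ℝ)
      rwa [ENNReal.zero_rpow_of_pos (by norm_num)] at this
    have := ENNReal.Tendsto.mul_const h1 (Or.inr hS_top)
    rwa [zero_mul] at this
  have hε2 : (0 : ℝ≥0∞) < ENNReal.ofReal (ε / 2) := ENNReal.ofReal_pos.2 (half_pos hε)
  have hev : ∀ᶠ t in 𝓝[>] (0 : ℝ),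
      (∫⁻ x in K, ‖u t x - u₀ x‖ₑ ^ 2) ^ (1 / 2 : ℝ) * S < ENNReal.ofReal (ε / 2) :=
    hcs.eventually (gt_mem_nhds hε2)
  obtain ⟨τ₂, hτ₂, hsub₂⟩ := mem_nhdsGT_iff_exists_Ioo_subset.1 hev
  -- the final `τ`
  set τ : ℝ := min (min d τ₂) T with hτ
  have hτ0 : 0 < τ := lt_min (lt_min hd hτ₂) hT
  refine ⟨τ, hτ0, ?_⟩
  have hgood' : ∀ᵐ t ∂((volume : Measure ℝ).restrict (Ioo 0 τ)),
      (AEStronglyMeasurable (u t) (volume : Measure E) ∧ ∫⁻ x in K, ‖u t x‖ₑ ^ 2 < ∞) ∧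
        t ∈ Ioo 0 τ :=
    (ae_restrict_of_ae_restrict_of_subset (Ioo_subset_Ioo_right (min_le_right _ _)) hgood).and
      (ae_restrict_mem measurableSet_Ioo)
  filter_upwards [hgood'] with t ht
  obtain ⟨⟨hmt, hfin⟩, ht0, htτ⟩ := ht
  have htd : t < d := htτ.trans_le ((min_le_left _ _).trans (min_le_left _ _))
  have htτ₂ : t < τ₂ := htτ.trans_le ((min_le_left _ _).trans (min_le_right _ _))
  have hmtK : MemLp (u t) 2 μK := memLp_two_restrict_of_lintegral_lt_top hmt hfin
  have hit : Integrable (u t) μK := hmtK.integrable one_le_two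
  -- reduce the `E`-integrals to `K`-integrals
  have hred : ∀ (v : E → E) (s : ℝ), ∫ x, ⟪v x, ψ s x⟫ = ∫ x, ⟪v x, ψ s x⟫ ∂μK := by
    intro v s
    rw [hμK]
    exact (setIntegral_eq_integral_of_forall_compl_eq_zero fun x hx => by
      rw [hψK s x hx, inner_zero_right]).symm
  rw [hred (u t) t, hred u₀ 0]
  have hψc_slice : ∀ s, Continuous (ψ s) := fun s => hψc.comp (Continuous.prodMk_right s)
  have hint : ∀ {v : E → E}, Integrable v μK → ∀ s, Integrable (fun x => ⟪v x, ψ s x⟫) μK := by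
    intro v hv s
    refine Integrable.mono' (hv.norm.mul_const Cψ)
      (hv.1.inner (hψc_slice s).aestronglyMeasurable) ?_
    filter_upwards with x
    exact (norm_inner_le_norm _ _).trans (mul_le_mul_of_nonneg_left (hCψ' s x) (norm_nonneg _))
  -- split the difference
  have hsplit : (∫ x, ⟪u t x, ψ t x⟫ ∂μK) - ∫ x, ⟪u₀ x, ψ 0 x⟫ ∂μK =
      (∫ x, ⟪u t x - u₀ x, ψ t x⟫ ∂μK) + ∫ x, ⟪u₀ x, ψ t x - ψ 0 x⟫ ∂μK := by
    have i1 : Integrable (fun x => ⟪u t x - u₀ x, ψ t x⟫) μK := hint (hit.sub hi₀) t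
    have i2 : Integrable (fun x => ⟪u₀ x, ψ t x - ψ 0 x⟫) μK := by
      have := (hint hi₀ t).sub (hint hi₀ 0)
      refine this.congr (Eventually.of_forall fun x => ?_)
      simp only [Pi.sub_apply, inner_sub_right]
    rw [← integral_sub (hint hit t) (hint hi₀ 0), ← integral_add i1 i2]
    refine integral_congr_ae (Eventually.of_forall fun x => ?_)
    simp only [inner_sub_left, inner_sub_right]
    ring
  rw [hsplit]
  -- first term: Cauchy–Schwarz
  have h1 : |∫ x, ⟪u t x - u₀ x, ψ t x⟫ ∂μK| ≤ ε / 2 := by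
    have hcs1 : ‖∫ x, ⟪u t x - u₀ x, ψ t x⟫ ∂μK‖ₑ ≤
        eLpNorm (fun x => u t x - u₀ x) 2 μK * eLpNorm (ψ t) 2 μK :=
      FunctionSpaces.enorm_integral_inner_le_eLpNorm_mul (F := fun x => u t x - u₀ x)
        (hmt.sub hm₀).restrict (hψc_slice t).aestronglyMeasurable
    have heq : eLpNorm (fun x => u t x - u₀ x) 2 μK =
        (∫⁻ x in K, ‖u t x - u₀ x‖ₑ ^ 2) ^ (1 / 2 : ℝ) := by
      rw [eLpNorm_eq_lintegral_rpow_enorm_toReal two_ne_zero ENNReal.ofNat_ne_top,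
        ENNReal.toReal_ofNat]
      simp only [ENNReal.rpow_two, hμK]
    have hlt : ‖∫ x, ⟪u t x - u₀ x, ψ t x⟫ ∂μK‖ₑ < ENNReal.ofReal (ε / 2) := by
      refine lt_of_le_of_lt (hcs1.trans ?_) (hsub₂ ⟨ht0, htτ₂⟩)
      rw [heq]
      exact mul_le_mul' le_rfl (hψS t)
    rw [Real.enorm_eq_ofReal_abs, ENNReal.ofReal_lt_ofReal_iff (half_pos hε)] at hlt
    exact hlt.le
  -- second term: uniform continuity
  have h2 : |∫ x, ⟪u₀ x, ψ t x - ψ 0 x⟫ ∂μK| ≤ ε / 2 := by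
    have hb : ∀ᵐ x ∂μK, ‖⟪u₀ x, ψ t x - ψ 0 x⟫‖ ≤ ‖u₀ x‖ * ε₁ := by
      filter_upwards with x
      refine (norm_inner_le_norm _ _).trans (mul_le_mul_of_nonneg_left ?_ (norm_nonneg _))
      exact hdψ t x (by rwa [abs_of_pos ht0])
    have hne : I₀ + 1 ≠ 0 := by linarith
    have hfrac : I₀ / (I₀ + 1) ≤ 1 := (div_le_one (by linarith)).2 (by linarith)
    calc |∫ x, ⟪u₀ x, ψ t x - ψ 0 x⟫ ∂μK| ≤ ∫ x, ‖u₀ x‖ * ε₁ ∂μK := by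
          rw [← Real.norm_eq_abs]
          exact norm_integral_le_of_norm_le (hi₀.norm.mul_const _) hb
      _ = I₀ * ε₁ := by rw [integral_mul_const]
      _ = ε / 2 * (I₀ / (I₀ + 1)) := by rw [hε₁]; field_simp
      _ ≤ ε / 2 * 1 := by gcongr
      _ = ε / 2 := mul_one _
  calc |(∫ x, ⟪u t x - u₀ x, ψ t x⟫ ∂μK) + ∫ x, ⟪u₀ x, ψ t x - ψ 0 x⟫ ∂μK|
      ≤ |∫ x, ⟪u t x - u₀ x, ψ t x⟫ ∂μK| + |∫ x, ⟪u₀ x, ψ t x - ψ 0 x⟫ ∂μK| := abs_add_le _ _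
    _ ≤ ε / 2 + ε / 2 := add_le_add h1 h2
    _ = ε := add_halves ε

end Hyp

/-! ### The weak identity with datum, and the corrected fact -/

section Datum

variable {E : Type*} [NormedAddCommGroup E] [InnerProductSpace ℝ E] [FiniteDimensional ℝ E]
  [MeasurableSpace E] [BorelSpace E]
variable {T ν : ℝ} {f u : ℝ → E → E} {u₀ : E → E} {p : ℝ → E → ℝ}

/-- **The cut-off argument.** Let `(u, p)` satisfy the pressure-explicit identity against all
test fields on the open slab `(0,T) × E`, with `u, ‖u‖²` and `f` integrable on the finite
cylinders `(0,T) × K`, a.e. slice of `u` measurable and locally `L²`, `u₀` measurable and locally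
`L²`, and `u(t) → u₀` in `L²_loc` as `t → 0⁺`. Then for every test field `ψ` on `(-∞, T) × E`
with divergence-free slices
`∫₀ᵀ ∫ (⟪u, ∂ₜψ⟫ + ⟪u, (u·∇)ψ⟫ + ν ⟪u, Δψ⟫ + ⟪f, ψ⟫) + ∫ ⟪u₀, ψ(0)⟫ = 0`:
test the pressure-explicit identity with `η_δ(t) ψ(t,x)` (`η_δ` a smooth monotone cut-off,
`0` near `t = 0`), where `∫∫ p div(η_δ ψ) = 0`, and let `δ → 0`: `∫∫ η_δ Φ → ∫∫ Φ` by dominated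
convergence and `∫∫ η_δ' ⟪u, ψ⟫ = ∫ η_δ'(t) ⟨u(t), ψ(t)⟩ dt → ⟨u₀, ψ(0)⟩` since `η_δ' ≥ 0` has
unit mass concentrating at `0⁺` (Robinson–Rodrigo–Sadowski 2016, §3.1, PDF p. 58: the time
integration by parts producing `⟨u(0), φ(0)⟩`; Caffarelli–Kohn–Nirenberg 1982, §2
(2.1)–(2.5)). [cite: RobinsonRodrigoSadowski2016, §3.1 p. 58 (3.1)] -/
theorem weakIdentity_datum_of_distributional (hT : 0 < T)
    (hUK : ∀ K : Set E, IsCompact K → IntegrableOn (uncurry u) (Ioo 0 T ×ˢ K) volume ∧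
      IntegrableOn (fun z => ‖uncurry u z‖ ^ 2) (Ioo 0 T ×ˢ K) volume)
    (hmom : ∀ ψ : ℝ → E → E, IsSpaceTimeTestOn (slab E (Ioo 0 T) isOpen_Ioo) ψ →
      ∫ z in Ioo 0 T ×ˢ (univ : Set E), (⟪u z.1 z.2, timeDeriv ψ z.1 z.2⟫ +
        ⟪u z.1 z.2, convect (u z.1) (ψ z.1) z.2⟫ + ν * ⟪u z.1 z.2, Δ (ψ z.1) z.2⟫ +
        p z.1 z.2 * VectorCalculus.divergence (ψ z.1) z.2 + ⟪f z.1 z.2, ψ z.1 z.2⟫) = 0)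
    (hf : ∀ K : Set E, IsCompact K → IntegrableOn (uncurry f) (Ioo 0 T ×ˢ K) volume)
    (hgood : ∀ᵐ t ∂((volume : Measure ℝ).restrict (Ioo 0 T)),
      AEStronglyMeasurable (u t) (volume : Measure E) ∧
        ∀ n : ℕ, ∫⁻ x in closedBall (0 : E) n, ‖u t x‖ₑ ^ 2 < ∞)
    (hm₀ : AEStronglyMeasurable u₀ (volume : Measure E))
    (h₀ : ∀ K : Set E, IsCompact K →
      Tendsto (fun t => ∫⁻ x in K, ‖u t x - u₀ x‖ₑ ^ 2) (𝓝[>] 0) (𝓝 0))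
    {ψ : ℝ → E → E} (hψ : IsSpaceTimeTestOn (slab E (Iio T) isOpen_Iio) ψ)
    (hdiv : ∀ t, VectorCalculus.IsDivFree (ψ t)) :
    (∫ t in Ioo 0 T, ∫ x, (⟪u t x, timeDeriv ψ t x⟫ + ⟪u t x, convect (u t) (ψ t) x⟫ +
        ν * ⟪u t x, Δ (ψ t) x⟫ + ⟪f t x, ψ t x⟫)) + ∫ x, ⟪u₀ x, ψ 0 x⟫ = 0 := by
  -- the compact `x`-shadow of `ψ`, enlarged to a closed ball `K`
  obtain ⟨K₀, hK₀, hK₀t⟩ := hψ.exists_compact_slice_subset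
  obtain ⟨r, hr⟩ := hK₀.isBounded.subset_closedBall (0 : E)
  set n : ℕ := ⌈r⌉₊ with hn
  set K : Set E := closedBall (0 : E) n with hK_def
  have hK : IsCompact K := isCompact_closedBall _ _
  have hKt : ∀ t, tsupport (ψ t) ⊆ K := fun t =>
    (hK₀t t).trans (hr.trans (closedBall_subset_closedBall (Nat.le_ceil r)))
  have hψ0 : ∀ t x, x ∉ K → ψ t x = 0 := fun t x hx =>
    image_eq_zero_of_notMem_tsupport fun h' => hx (hKt t h')
  -- regularity of the test-field ingredients as functions on `ℝ × E`
  have cψ : Continuous (uncurry ψ) := hψ.contDiff.continuous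
  have cψ' : Continuous (uncurry (timeDeriv ψ)) := hψ.continuous_timeDeriv
  have cD : Continuous fun z : ℝ × E => fderiv ℝ (ψ z.1) z.2 := by
    have h := ((hψ.isSmoothSpaceTimeOn univ).fderiv_slice uniqueDiffOn_univ).continuousOn
    rw [univ_prod_univ, continuousOn_univ] at h
    exact h
  have cL : Continuous fun z : ℝ × E => Δ (ψ z.1) z.2 := by
    have h := ((hψ.isSmoothSpaceTimeOn univ).laplacian uniqueDiffOn_univ).continuousOn
    rw [univ_prod_univ, continuousOn_univ] at h
    exact h
  have hψd : ∀ t, Differentiable ℝ (ψ t) := fun t =>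
    (hψ.contDiff_slice t).differentiable (by simp)
  have hψ2 : ∀ t, ContDiff ℝ 2 (ψ t) := fun t => contDiff_infty.1 (hψ.contDiff_slice t) 2
  have hD0 : ∀ t x, x ∉ K → fderiv ℝ (ψ t) x = 0 := fun t x hx =>
    fderiv_of_notMem_tsupport ℝ fun h => hx (hKt t h)
  have hL0 : ∀ t x, x ∉ K → Δ (ψ t) x = 0 := fun t x hx =>
    laplacian_eq_zero_of_notMem_tsupport fun h => hx (hKt t h)
  have hψ'0 : ∀ t x, x ∉ K → timeDeriv ψ t x = 0 := fun t x hx =>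
    timeDeriv_eq_zero_of_forall (fun s => hψ0 s x hx) t
  -- integrability on the slab
  obtain ⟨hUK1, hUK2⟩ := hUK K hK
  have iA : Integrable (fun z : ℝ × E => ⟪u z.1 z.2, timeDeriv ψ z.1 z.2⟫)
      (((volume : Measure ℝ).restrict (Ioo 0 T)).prod (volume : Measure E)) :=
    integrable_slab_inner hK hUK1 cψ' hψ'0
  have iB : Integrable (fun z : ℝ × E => ⟪u z.1 z.2, convect (u z.1) (ψ z.1) z.2⟫)
      (((volume : Measure ℝ).restrict (Ioo 0 T)).prod (volume : Measure E)) :=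
    integrable_slab_inner_clm_apply hK hUK1 hUK2 cD hD0
  have iC : Integrable (fun z : ℝ × E => ⟪u z.1 z.2, Δ (ψ z.1) z.2⟫)
      (((volume : Measure ℝ).restrict (Ioo 0 T)).prod (volume : Measure E)) :=
    integrable_slab_inner hK hUK1 cL hL0
  have iF : Integrable (fun z : ℝ × E => ⟪f z.1 z.2, ψ z.1 z.2⟫)
      (((volume : Measure ℝ).restrict (Ioo 0 T)).prod (volume : Measure E)) :=
    integrable_slab_inner hK (hf K hK) cψ hψ0
  have iU : Integrable (fun z : ℝ × E => ⟪u z.1 z.2, ψ z.1 z.2⟫)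
      (((volume : Measure ℝ).restrict (Ioo 0 T)).prod (volume : Measure E)) :=
    integrable_slab_inner hK hUK1 cψ hψ0
  set Φ : ℝ × E → ℝ := fun z => ⟪u z.1 z.2, timeDeriv ψ z.1 z.2⟫ +
    ⟪u z.1 z.2, convect (u z.1) (ψ z.1) z.2⟫ + ν * ⟪u z.1 z.2, Δ (ψ z.1) z.2⟫ +
    ⟪f z.1 z.2, ψ z.1 z.2⟫ with hΦ
  have iΦ : Integrable Φ (((volume : Measure ℝ).restrict (Ioo 0 T)).prod (volume : Measure E)) :=
    ((iA.add iB).add (iC.const_mul ν)).add iF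
  -- the pairing `U(t) = ⟨u(t), ψ(t)⟩` and its a.e. limit at `0⁺`
  set U : ℝ → ℝ := fun t => ∫ x, ⟪u t x, ψ t x⟫ with hU_def
  set L : ℝ := ∫ x, ⟪u₀ x, ψ 0 x⟫ with hL_def
  have hUint : IntegrableOn U (Ioo 0 T) := iU.integral_prod_left
  have hgoodK : ∀ᵐ t ∂((volume : Measure ℝ).restrict (Ioo 0 T)),
      AEStronglyMeasurable (u t) (volume : Measure E) ∧ ∫⁻ x in K, ‖u t x‖ₑ ^ 2 < ∞ := by
    filter_upwards [hgood] with t ht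
    exact ⟨ht.1, ht.2 n⟩
  have hu₀ : ∫⁻ x in K, ‖u₀ x‖ₑ ^ 2 < ∞ := lintegral_datum_sq_lt_top hT hgoodK hm₀ (h₀ K hK)
  have hlim : ∀ ε > 0, ∃ τ > 0, ∀ᵐ t ∂((volume : Measure ℝ).restrict (Ioo 0 τ)), |U t - L| ≤ ε :=
    fun ε hε => exists_ae_abs_pairing_sub_datum_le hT hK hgoodK hm₀ hu₀ (h₀ K hK) cψ
      hψ.hasCompactSupport hψ0 hε
  -- the cut-offs `η k` with derivatives `ρ k`, at scale `δ k = T / (6 (k + 1))`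
  set δ : ℕ → ℝ := fun k => T / (6 * ((k : ℝ) + 1)) with hδ
  have hδ0 : ∀ k, 0 < δ k := fun k => by positivity
  have hδT : ∀ k, 3 * δ k ≤ T := fun k => by
    have hk : (0 : ℝ) ≤ k := Nat.cast_nonneg k
    have h1 : δ k ≤ T / 6 := by
      show T / (6 * ((k : ℝ) + 1)) ≤ T / 6
      exact div_le_div_of_nonneg_left hT.le (by norm_num) (by nlinarith)
    linarith
  have hδlim : Tendsto δ atTop (𝓝 0) := by
    have h1 : Tendsto (fun k : ℕ => (k : ℝ) + 1) atTop atTop :=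
      tendsto_atTop_add_const_right _ 1 tendsto_natCast_atTop_atTop
    have h2 : Tendsto (fun k : ℕ => 6 * ((k : ℝ) + 1)) atTop atTop :=
      h1.const_mul_atTop (by norm_num)
    exact tendsto_const_nhds.div_atTop h2
  obtain hcut : ∀ k, ∃ η ρ : ℝ → ℝ, ContDiff ℝ (⊤ : ℕ∞) η ∧ Continuous ρ ∧
      (∀ s, HasDerivAt η (ρ s) s) ∧ (∀ s, s ≤ δ k → η s = 0) ∧ (∀ s, 3 * δ k ≤ s → η s = 1) ∧
      (∀ s, η s ∈ Icc (0 : ℝ) 1) ∧ (∀ s, 0 ≤ ρ s) ∧ (∀ s, s ∉ Ioo (δ k) (3 * δ k) → ρ s = 0) ∧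
      ∫ s, ρ s = 1 := fun k => exists_smooth_time_cutoff (hδ0 k)
  choose η ρ hηs hρc hηρ hη0 hη1 hη01 hρ0 hρsupp hρ1 using hcut
  have hηabs : ∀ k s, |η k s| ≤ 1 := fun k s => by
    rw [abs_le]
    exact ⟨by linarith [(hη01 k s).1], (hη01 k s).2⟩
  have hρC : ∀ k, ∃ C, 0 ≤ C ∧ ∀ s, |ρ k s| ≤ C := fun k =>
    exists_abs_le_of_eq_zero_off_Ioo (hρc k) (hρsupp k)
  -- Step 1: the tested identity for each `k`
  have hAB : ∀ k, (∫ z, η k z.1 * Φ z ∂(((volume : Measure ℝ).restrict (Ioo 0 T)).prod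
      (volume : Measure E))) + ∫ t in Ioo 0 T, ρ k t * U t = 0 := by
    intro k
    obtain ⟨C, -, hC⟩ := hρC k
    have hψk : IsSpaceTimeTestOn (slab E (Ioo 0 T) isOpen_Ioo) (fun s x => η k s • ψ s x) :=
      hψ.cutoff (hδ0 k) (hηs k) (hη0 k)
    have key := hmom _ hψk
    have key' : ∫ z in Ioo 0 T ×ˢ (univ : Set E),
        (ρ k z.1 * ⟪u z.1 z.2, ψ z.1 z.2⟫ + η k z.1 * Φ z) = 0 := by
      refine Eq.trans (setIntegral_congr_fun (measurableSet_Ioo.prod MeasurableSet.univ)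
        fun z _ => ?_) key
      rw [hΦ]
      dsimp only
      rw [timeDeriv_cutoff (hηρ k) hψ.hasDerivAt_time, convect_fun_const_smul _ (hψd z.1 z.2),
        laplacian_fun_const_smul (hψ2 z.1), divergence_fun_const_smul (hψd z.1 z.2), hdiv z.1 z.2]
      simp only [inner_add_right, real_inner_smul_right]
      ring
    have iρU : Integrable (fun z : ℝ × E => ρ k z.1 * ⟪u z.1 z.2, ψ z.1 z.2⟫)
        (((volume : Measure ℝ).restrict (Ioo 0 T)).prod (volume : Measure E)) :=
      integrable_time_mul iU (hρc k) hC
    have iηΦ : Integrable (fun z : ℝ × E => η k z.1 * Φ z)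
        (((volume : Measure ℝ).restrict (Ioo 0 T)).prod (volume : Measure E)) :=
      integrable_time_mul iΦ (hηs k).continuous (hηabs k)
    rw [volume_restrict_slab_eq, integral_add iρU iηΦ, integral_prod _ iρU] at key'
    simp only [integral_const_mul] at key'
    rw [add_comm]
    exact key'
  -- Step 2: the limits `k → ∞`
  have hA : Tendsto (fun k => ∫ z, η k z.1 * Φ z ∂(((volume : Measure ℝ).restrict (Ioo 0 T)).prod
      (volume : Measure E))) atTop
      (𝓝 (∫ z, Φ z ∂(((volume : Measure ℝ).restrict (Ioo 0 T)).prod (volume : Measure E)))) := by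
    refine tendsto_integral_of_dominated_convergence (fun z => ‖Φ z‖)
      (fun k => (integrable_time_mul iΦ (hηs k).continuous (hηabs k)).aestronglyMeasurable)
      iΦ.norm (fun k => Eventually.of_forall fun z => ?_) ?_
    · rw [norm_mul, Real.norm_eq_abs]
      exact mul_le_of_le_one_left (norm_nonneg _) (hηabs k z.1)
    · have hmem : ∀ᵐ z ∂(((volume : Measure ℝ).restrict (Ioo 0 T)).prod (volume : Measure E)),
          z ∈ Ioo 0 T ×ˢ (univ : Set E) := by
        rw [← volume_restrict_slab_eq]
        exact ae_restrict_mem (measurableSet_Ioo.prod MeasurableSet.univ)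
      filter_upwards [hmem] with z hz
      have hz1 : 0 < z.1 := hz.1.1
      have h3 : Tendsto (fun k => 3 * δ k) atTop (𝓝 0) := by
        simpa using hδlim.const_mul 3
      have hev : ∀ᶠ k in atTop, 3 * δ k < z.1 := (tendsto_order.1 h3).2 _ hz1
      refine (tendsto_const_nhds (x := Φ z)).congr' ?_
      filter_upwards [hev] with k hk
      rw [hη1 k z.1 hk.le, one_mul]
  have hB : Tendsto (fun k => ∫ t in Ioo 0 T, ρ k t * U t) atTop (𝓝 L) :=
    tendsto_setIntegral_mul_of_ae_tendsto hUint hlim hδlim hδ0 hδT hρc hρ0 hρsupp hρ1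
  have hsum : (∫ z, Φ z ∂(((volume : Measure ℝ).restrict (Ioo 0 T)).prod (volume : Measure E))) +
      L = 0 :=
    tendsto_nhds_unique (hA.add hB) (by simpa only [hAB] using tendsto_const_nhds)
  rw [integral_prod _ iΦ] at hsum
  exact hsum

/-- **Dropping the pressure — corrected statement** of the named fact
`IsDistributionalNSSolutionOn.isWeakNSSolutionOn_of` (`WeakSolution`): the datum `u₀` is in
addition assumed a.e.-strongly measurable (`hm₀`). As vendored, `isWeakNSSolutionOn_of`
quantifies over an arbitrary `u₀ : E → E` constrained only through the lower Lebesgue integrals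
`∫⁻_K ‖u(t) - u₀‖ₑ²`, which are insensitive to adding to `u₀` a non-measurable field `𝟙_A w` with
`A` of inner measure zero, whereas the Bochner integral `∫ ⟪u₀, ψ(0)⟫` of the conclusion then
changes (it is `0` by convention on non-measurable integrands); so the uncorrected statement
fails in dimension `≥ 2` and the measurability of the datum — implicit in every printed source,
where `u₀ ∈ L²_loc` — has to be an explicit hypothesis. Statement: a distributional
(pressure-explicit) solution on the slab `(0, T) × E` (Caffarelli–Kohn–Nirenberg 1982, (2.1)–(2.5))
which is locally square integrable up to `t = 0`, with force integrable on the finite cylinders,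
attaining the measurable datum `u₀` in `L²_loc` as `t → 0⁺`, is a weak (pressure-free) solution
on `[0, T)` with datum `u₀` (Leray's form (17); Robinson–Rodrigo–Sadowski 2016, §3.1,
(3.1)). [cite: CaffarelliKohnNirenberg1982, §2 (2.1)–(2.5)] -/
def IsDistributionalNSSolutionOn.isWeakNSSolutionOn_of_aestronglyMeasurable : Prop :=
  ∀ (h : IsDistributionalNSSolutionOn (slab E (Ioo 0 T) isOpen_Ioo) ν f u p)
    (hu : ∀ K : Set E, IsCompact K → ∫⁻ z in Ioo 0 T ×ˢ K, ‖uncurry u z‖ₑ ^ 2 < ∞)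
    (hf : ∀ K : Set E, IsCompact K → IntegrableOn (uncurry f) (Ioo 0 T ×ˢ K) volume)
    (hm₀ : AEStronglyMeasurable u₀ volume)
    (h₀ : ∀ K : Set E, IsCompact K →
      Filter.Tendsto (fun t => ∫⁻ x in K, ‖u t x - u₀ x‖ₑ ^ 2) (nhdsWithin 0 (Ioi 0)) (nhds 0)),
    IsWeakNSSolutionOn T ν f u₀ u

/-- **Discharge of the corrected fact** `isWeakNSSolutionOn_of_aestronglyMeasurable`:
measurability on the slab is that of a locally integrable function; local square integrability
up to `t = 0` is the hypothesis; a.e. weak divergence-freeness is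
`ae_integral_inner_gradient_eq_zero` (test with `η ⊗ θ`, Fubini, du Bois-Reymond in `t`) made
uniform in `θ` by the separability argument `ae_isWeaklyDivFree_of_forall_test`; the weak
identity with datum is the cut-off argument `weakIdentity_datum_of_distributional` (for `T ≤ 0`
it is vacuous: `(0,T) = ∅` and `ψ(0) = 0`). [cite: CaffarelliKohnNirenberg1982, §2 (2.1)–(2.5)] -/
theorem IsDistributionalNSSolutionOn.isWeakNSSolutionOn_of_aestronglyMeasurable_holds :
    IsDistributionalNSSolutionOn.isWeakNSSolutionOn_of_aestronglyMeasurable (E := E) (T := T)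
      (ν := ν) (f := f) (u := u) (u₀ := u₀) (p := p) := by
  intro h hu hf hm₀ h₀
  obtain ⟨hL1, -, -, hdivQ, hmomQ⟩ := h
  have hmeas : AEStronglyMeasurable (uncurry u)
      ((volume : Measure (ℝ × E)).restrict (Ioo 0 T ×ˢ univ)) := hL1.aestronglyMeasurable
  have hUK : ∀ K : Set E, IsCompact K → IntegrableOn (uncurry u) (Ioo 0 T ×ˢ K) volume ∧
      IntegrableOn (fun z => ‖uncurry u z‖ ^ 2) (Ioo 0 T ×ˢ K) volume := fun K hK =>
    integrableOn_cylinder_of_lintegral_sq_slab hmeas hu hK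
  have hgood := ae_slice_aestronglyMeasurable_and_lintegral_ball_lt_top hmeas hu
  refine ⟨hmeas, hu, ?_, fun ψ hψ hdiv => ?_⟩
  · exact ae_isWeaklyDivFree_of_forall_test hgood fun θ hθ =>
      Literature.Analysis.FluidPDE.ae_integral_inner_gradient_eq_zero hdivQ (fun K hK => (hUK K hK).1) hθ
  · rcases le_or_gt T 0 with hT | hT
    · have h0 : ∀ x, ψ 0 x = 0 := fun x => hψ.apply_eq_zero (by simp [hT])
      simp [Ioo_eq_empty_of_le hT, h0]
    · exact weakIdentity_datum_of_distributional hT hUK hmomQ hf hgood hm₀ h₀ hψ hdiv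

/-- The corrected fact as a usable lemma: a distributional solution on `(0,T) × E`, locally
square integrable up to `t = 0`, with force integrable on the finite cylinders and attaining the
measurable datum `u₀` in `L²_loc`, is a weak solution on `[0, T)` with datum `u₀`
(`isWeakNSSolutionOn_of_aestronglyMeasurable_holds`; Caffarelli–Kohn–Nirenberg 1982,
§2). [cite: CaffarelliKohnNirenberg1982, §2 (2.1)–(2.5)] -/
theorem IsDistributionalNSSolutionOn.isWeakNSSolutionOn_datum
    (h : IsDistributionalNSSolutionOn (slab E (Ioo 0 T) isOpen_Ioo) ν f u p)
    (hu : ∀ K : Set E, IsCompact K → ∫⁻ z in Ioo 0 T ×ˢ K, ‖uncurry u z‖ₑ ^ 2 < ∞)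
    (hf : ∀ K : Set E, IsCompact K → IntegrableOn (uncurry f) (Ioo 0 T ×ˢ K) volume)
    (hm₀ : AEStronglyMeasurable u₀ volume)
    (h₀ : ∀ K : Set E, IsCompact K →
      Filter.Tendsto (fun t => ∫⁻ x in K, ‖u t x - u₀ x‖ₑ ^ 2) (nhdsWithin 0 (Ioi 0)) (nhds 0)) :
    IsWeakNSSolutionOn T ν f u₀ u :=
  IsDistributionalNSSolutionOn.isWeakNSSolutionOn_of_aestronglyMeasurable_holds h hu hf hm₀ h₀

end Datum

/-! ### Why the vendored statement needs the measurability of the datum -/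

section Loophole

variable {E : Type*} [NormedAddCommGroup E] [InnerProductSpace ℝ E] [FiniteDimensional ℝ E]
  [MeasurableSpace E] [BorelSpace E]

/-- `(a + b)² ≤ 2a² + 2b²` in `ℝ≥0∞`. [folklore] -/
theorem ennreal_add_sq_le (a b : ℝ≥0∞) : (a + b) ^ 2 ≤ 2 * a ^ 2 + 2 * b ^ 2 := by
  have h := ENNReal.rpow_add_le_mul_rpow_add_rpow a b (p := 2) one_le_two
  norm_num [ENNReal.rpow_two] at h
  simpa [mul_add] using h

omit [NormedAddCommGroup E] [InnerProductSpace ℝ E] [FiniteDimensional ℝ E] [BorelSpace E] in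
/-- **Lower integrals do not see perturbations supported on inner-null sets.** If every measurable
subset of `A` is `μ`-null, then `∫⁻ 𝟙_A c dμ = 0` for every constant `c` — although `A` itself
need not be (null-)measurable (e.g. a Bernstein set for Lebesgue measure): every simple function
below `𝟙_A c` has measurable support inside `A`. [folklore] -/
theorem lintegral_indicator_const_eq_zero_of_forall_subset_null {μ : Measure E} {A : Set E}
    (hA : ∀ B : Set E, MeasurableSet B → B ⊆ A → μ B = 0) (c : ℝ≥0∞) :
    ∫⁻ x, A.indicator (fun _ => c) x ∂μ = 0 := by
  rw [lintegral_def]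
  refine le_antisymm (iSup₂_le fun g hg => ?_) bot_le
  have hB : μ {x | (g : E → ℝ≥0∞) x ≠ 0} = 0 := by
    refine hA _ (g.measurableSet_preimage {0}ᶜ) fun x hx => ?_
    by_contra hxA
    have h1 : (g : E → ℝ≥0∞) x ≤ A.indicator (fun _ => c) x := hg x
    rw [indicator_of_notMem hxA] at h1
    exact hx (le_antisymm h1 bot_le)
  have hg0 : (g : E → ℝ≥0∞) =ᵐ[μ] 0 := by
    rw [EventuallyEq, ae_iff]
    simpa using hB
  rw [← SimpleFunc.lintegral_eq_lintegral, lintegral_congr_ae hg0]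
  simp

/-- **The datum hypothesis of the uncorrected fact is blind to such perturbations.** If `u(t)`
and `u₀` are measurable and `g` is a field with `∫⁻_K ‖g‖ₑ² = 0` (lower integral; e.g.
`g = 𝟙_A w` as above), then `∫⁻_K ‖u(t) - u₀‖ₑ² → 0` as `t → 0⁺` implies
`∫⁻_K ‖u(t) - (u₀ + g)‖ₑ² → 0`: by `‖u(t) - u₀ - g‖ₑ² ≤ 2‖u(t) - u₀‖ₑ² + 2‖g‖ₑ²` and Mathlib's
`lintegral_add_left`, which needs measurability of the *first* summand only. Hence the hypothesis
`h₀` of `IsDistributionalNSSolutionOn.isWeakNSSolutionOn_of` cannot force the datum to be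
measurable, which is why the corrected fact assumes it. [folklore] -/
theorem tendsto_lintegral_sub_add_of_lintegral_eq_zero {u : ℝ → E → E} {u₀ g : E → E}
    (hum : ∀ t, Measurable (u t)) (hm₀ : Measurable u₀) {K : Set E}
    (hg : ∫⁻ x in K, ‖g x‖ₑ ^ 2 = 0)
    (h₀ : Tendsto (fun t => ∫⁻ x in K, ‖u t x - u₀ x‖ₑ ^ 2) (𝓝[>] 0) (𝓝 0)) :
    Tendsto (fun t => ∫⁻ x in K, ‖u t x - (u₀ x + g x)‖ₑ ^ 2) (𝓝[>] 0) (𝓝 0) := by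
  have hup : Tendsto (fun t => 2 * ∫⁻ x in K, ‖u t x - u₀ x‖ₑ ^ 2) (𝓝[>] 0) (𝓝 0) := by
    have h2 : Tendsto (fun t => 2 * ∫⁻ x in K, ‖u t x - u₀ x‖ₑ ^ 2) (𝓝[>] 0) (𝓝 (2 * 0)) :=
      ENNReal.Tendsto.const_mul h₀ (Or.inr (ENNReal.ofNat_ne_top (n := 2)))
    rwa [mul_zero] at h2
  refine tendsto_of_tendsto_of_tendsto_of_le_of_le tendsto_const_nhds hup (fun t => bot_le)
    fun t => ?_
  have hmeas1 : Measurable fun x => ‖u t x - u₀ x‖ₑ ^ 2 := ((hum t).sub hm₀).enorm.pow_const 2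
  have hmeas : Measurable fun x => 2 * ‖u t x - u₀ x‖ₑ ^ 2 := hmeas1.const_mul 2
  calc ∫⁻ x in K, ‖u t x - (u₀ x + g x)‖ₑ ^ 2
      ≤ ∫⁻ x in K, (2 * ‖u t x - u₀ x‖ₑ ^ 2 + 2 * ‖g x‖ₑ ^ 2) := by
        refine lintegral_mono fun x => ?_
        have h1 : ‖u t x - (u₀ x + g x)‖ₑ ≤ ‖u t x - u₀ x‖ₑ + ‖g x‖ₑ := by
          rw [← sub_sub]
          exact enorm_sub_le
        calc ‖u t x - (u₀ x + g x)‖ₑ ^ 2 ≤ (‖u t x - u₀ x‖ₑ + ‖g x‖ₑ) ^ 2 := by gcongr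
          _ ≤ 2 * ‖u t x - u₀ x‖ₑ ^ 2 + 2 * ‖g x‖ₑ ^ 2 := ennreal_add_sq_le _ _
    _ = (2 * ∫⁻ x in K, ‖u t x - u₀ x‖ₑ ^ 2) + 2 * ∫⁻ x in K, ‖g x‖ₑ ^ 2 := by
        rw [lintegral_add_left hmeas, lintegral_const_mul _ hmeas1,
          lintegral_const_mul' _ _ ENNReal.ofNat_ne_top]
    _ = 2 * ∫⁻ x in K, ‖u t x - u₀ x‖ₑ ^ 2 := by rw [hg, mul_zero, add_zero]

/-- For `g = 𝟙_A w` with `A` as in `lintegral_indicator_const_eq_zero_of_forall_subset_null`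
(w.r.t. `volume.restrict K`), the lower integral `∫⁻_K ‖g‖ₑ²` vanishes. [folklore] -/
theorem lintegral_indicator_datum_eq_zero {A K : Set E}
    (hA : ∀ B : Set E, MeasurableSet B → B ⊆ A → volume B = 0) (w : E) :
    ∫⁻ x in K, ‖A.indicator (fun _ => w) x‖ₑ ^ 2 = 0 := by
  have hpt : ∀ x, ‖A.indicator (fun _ => w) x‖ₑ ^ 2 = A.indicator (fun _ => ‖w‖ₑ ^ 2) x := by
    intro x
    by_cases hx : x ∈ A <;> simp [hx]
  simp_rw [hpt]
  refine lintegral_indicator_const_eq_zero_of_forall_subset_null (fun B hB hBA => ?_) _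
  exact le_antisymm ((Measure.restrict_le_self (s := K) B).trans (hA B hB hBA).le) bot_le

end Loophole

end Literature.Analysis.FluidPDE
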